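import Summits.QuantumFields.YangMills.Theorems.UnitScaleTiltProp7FrakGReality
import Summits.QuantumFields.YangMills.Theorems.UnitScaleTiltProp7SectET3DeltaOneT3SlotRealityRows
import HarnessLib

/-!
# Route `UnitScaleTilt`, crux K1 child «MinimiserStabilityRegPr» (stmt-QuantumFields-19200), skeleton v10, stub `stub_existenceMinimalOrbit` (EX),
# route (α) — **THE (R-𝒢) CLAUSE AT PRINT'S `Δ₁` SLOT: `𝔊 = G₁𝔓*` PROPER ([Balaban1985Variational] (110)–(111); [Balaban1985BackgroundPropagators] (3.128), (3.147), (3.153)) MAPS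
# HERMITIAN TRACELESS (−3)-DATA TO HERMITIAN TRACELESS (115)-FIELDS**, at the EX knit's LETTER OF RECORD `𝒢f L i U₀ := Prop7SectET3DeltaOne.frakGfOne … T_J U₀` (= `frakGfR` at
# `Δx := DeltaOne … T_J`), for `U₀ ∈ 𝔘_k(ε₀)` in the two windows, MODULO THE J-TERM'S THREE ROWS; UNCONDITIONAL at today's instantiation `T_J := 0` (`Δ₁ = Δ_π`)

Cell `ym3-torus`, width seat `ym-ust-20520-w4` (gen 5).  THEOREMS ONLY (0 `def`, 0 `sorry`).  The `Δ₁`-slot sibling of ✓`Prop7FrakGReality` (slot-generic (R-𝒢):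
`frakGfR_isHermitian_traceless_at_regPr (Δx) … (hΔx) (hΔtr) (hΔsymm)`), with the three `Δ₁` rows BY NAME from ym-inputs-p01's ✓`Prop7SectET3DeltaOne.DeltaOne_toL2_star_of_regPr` ∕
✓`trace_DeltaOne_toL2_eq_zero_of_regPr` ∕ ✓`DeltaOne_isSymmetric` — exactly as p01's ✓`H1f_isHermitian_traceless_at_regPr_DeltaOne` does for the `hH₁R` clause.  Nothing here closes the stub;
`--supports stmt-QuantumFields-19200 --as helper`, count-neutral.  YM₃ on T³ is a ladder rung (R3), not the Clay problem; nothing here claims the stub, the crux, d = 4 or the gap.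

THE PRINT.  [Balaban1985BackgroundPropagators] (3.127)–(3.128) p. 421 (`Δ₁`, `G₁`), (3.147) p. 425, (3.153) p. 426 (`𝔊 = G𝔓*`), p. 393 «The operators … are real»; [Balaban1985Variational]
(110)–(111) p. 294 «We denote by G₁ an inverse operator to the operator Δ₁ + DRD* + aQ*Q … the operator G₁𝔓* is equal to the operator 𝔊», (51) p. 286.

WHAT IS PROVED (member `F`, `h : n ≤ K`, weights `c₀ cB`, `a`; slot `TJ`; background `U₀ ∈ 𝔘_k(ε₀)`, windows `10⁹L²e ≤ 1`, `10¹²L³ε₀ ≤ 1`):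
★★★`frakGfR_isHermitian_traceless_at_regPr_DeltaOne (TJ) (hreg) (hT) (hTtr) (hTsymm)` — the knit's `h𝒢R` body at `frakGfR … (DeltaOne … T_J) U₀` modulo `T_J`'s σ-row, traceless row and
symmetry; ★★★`frakGfOne_isHermitian_traceless_at_regPr` — the same AT THE LETTER OF RECORD `frakGfOne … T_J U₀` (reducibly the same term); ★★★`frakGfR_isHermitian_traceless_at_regPr_DeltaOne_zero
(hreg)` — UNCONDITIONAL at `T_J := 0`; `frakGfR_isHermitian_traceless_at_regPr_DeltaPiSlot (hreg)` — the same read at `Δ_π` (✓`DeltaOne_zero`).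
NOT HERE: the three rows of the J-term OF RECORD `TJSlot` (ym-inputs-p01's `…DeltaOneT3JTerm` lane).
HONEST SCOPE.  Finite-dimensional Hilbert-space bookkeeping over landed letters; no estimate; N06 NOT discharged; no stub closed.

References: T. Bałaban, CMP 99 (1985) 389–434 [Balaban1985BackgroundPropagators] ((3.127)–(3.128) p.421, (3.147) p.425, (3.153) p.426, p.393); CMP 102 (1985) 277–309
[Balaban1985Variational] ((110)–(111) p.294, (115)–(117) pp.294–295, (51) p.286).
-/

set_option autoImplicit false

noncomputable section

open scoped InnerProductSpace ComplexConjugate Matrix.Norms.L2Operator BigOperators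

namespace Summit.QuantumFields.YangMills.Theorems.Prop7FrakGReality

open Literature.MathematicalPhysics.QuantumFieldTheory.Balaban1983to89
open Literature.MathematicalPhysics.QuantumFieldTheory.Balaban1983to89.T3ContinuumYM3Torus
open T3PrintedRegularMinimiser (RegPr)
open B9SectCLatticeCarrier (Bond)
open B11Eq103H1Complex (BondL2K)
open B11Eq115Space (NegSize JetSup NegSup)
open Summit.QuantumFields.YangMills.Theorems.Prop7SectET3Transport (periodsT3 bondEquiv bgOfCfg)
open Summit.QuantumFields.YangMills.Theorems.Prop7SectET3HilbertLetters (W₂ toL2)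
open Summit.QuantumFields.YangMills.Theorems.Prop7SectET3CurvedPropagators (frakGfR)
open Summit.QuantumFields.YangMills.Theorems.Prop7SectET3DeltaPi (DeltaPiSlot)
open Summit.QuantumFields.YangMills.Theorems.Prop7SectET3DeltaOne (DeltaOne frakGfOne DeltaOne_zero DeltaOne_isSymmetric DeltaOne_toL2_star_of_regPr trace_DeltaOne_toL2_eq_zero_of_regPr)

variable (F : T3Family) (n K : ℕ) (h : n ≤ K) (c₀ cB a : ℝ) [Fact (0 < c₀)] [Fact (0 < cB)]
variable (TJ : GaugeField (F.P K) 0 (Matrix.specialUnitaryGroup (Fin 2) ℂ) → (BondL2K ℂ 3 (periodsT3 F K) c₀ W₂ →ₗ[ℂ] BondL2K ℂ 3 (periodsT3 F K) c₀ W₂))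
variable (U₀ : GaugeField (F.P K) 0 (Matrix.specialUnitaryGroup (Fin 2) ℂ))
variable [Fact (0 < (F.L : ℝ))] [Fact (0 < ((F.L : ℝ)⁻¹) ^ (K - n))]

/-- ★★★ **(R-𝒢) AT PRINT'S `Δ₁` SLOT, MODULO THE J-TERM'S THREE ROWS**: at `U₀ ∈ 𝔘_k(ε₀)` in the windows, Hermitian traceless (−3)-data `f` give Hermitian traceless (115)-fields
`𝒢f f` for `frakGfR … (DeltaOne … T_J) U₀` — ✓`frakGfR_isHermitian_traceless_at_regPr` at `Δx := DeltaOne … T_J` with `hΔx`, `hΔtr`, `hΔsymm` from p01's ✓`DeltaOne_toL2_star_of_regPr`,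
✓`trace_DeltaOne_toL2_eq_zero_of_regPr`, ✓`DeltaOne_isSymmetric`; displayed: `T_J`'s σ-row `hT`, traceless row `hTtr`, symmetry `hTsymm`.
[cite: Balaban1985Variational, (110)–(111) p.294, (51) p.286; Balaban1985BackgroundPropagators, (3.128) p.421, (3.153) p.426, p.393] -/
theorem frakGfR_isHermitian_traceless_at_regPr_DeltaOne
    {ε₀ e : ℝ} (hε₀ : 0 < ε₀) (he : 0 < e) (hWe : 10 ^ 9 * (F.L : ℝ) ^ 2 * e ≤ 1) (hWε : 10 ^ 12 * (F.L : ℝ) ^ 3 * ε₀ ≤ 1) (hreg : RegPr F n K ε₀ U₀)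
    (hT : ∀ f : BondL2K ℂ 3 (periodsT3 F K) c₀ W₂, TJ U₀ (toL2 F K c₀ (star ((toL2 F K c₀).symm f))) = toL2 F K c₀ (star ((toL2 F K c₀).symm (TJ U₀ f))))
    (hTtr : ∀ A : PBond (F.P K) 0 → Matrix (Fin 2) (Fin 2) ℂ, (∀ b, (A b).trace = 0) → ∀ b, ((toL2 F K c₀).symm (TJ U₀ (toL2 F K c₀ A)) b).trace = 0)
    (hTsymm : (TJ U₀).IsSymmetric) :
    ∀ f : NegSize (F.L : ℝ) (((F.L : ℝ)⁻¹) ^ (K - n)) (fun _ : Bond 3 (periodsT3 F K) => K - n) 3 (Matrix (Fin 2) (Fin 2) ℂ),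
      (∀ b, (NegSup.equiv _ _ f b).IsHermitian ∧ (NegSup.equiv _ _ f b).trace = 0) →
      ∀ b, (JetSup.equiv _ _ _ (frakGfR F n K h c₀ cB a (DeltaOne F n K h c₀ cB a TJ) U₀ f) b).IsHermitian ∧
        (JetSup.equiv _ _ _ (frakGfR F n K h c₀ cB a (DeltaOne F n K h c₀ cB a TJ) U₀ f) b).trace = 0 :=
  frakGfR_isHermitian_traceless_at_regPr F n K h c₀ cB a U₀ (DeltaOne F n K h c₀ cB a TJ) hε₀ he hWe hWε hreg
    (DeltaOne_toL2_star_of_regPr F n K h c₀ cB a TJ U₀ hε₀ he hWe hWε hreg hT)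
    (trace_DeltaOne_toL2_eq_zero_of_regPr F n K h c₀ cB a TJ U₀ hε₀ he hWe hWε hreg hTtr hTsymm) (DeltaOne_isSymmetric (TJ := TJ) hTsymm)

/-- ★★★ **(R-𝒢) AT THE EX KNIT'S LETTER OF RECORD `frakGfOne … T_J U₀`** (✓`Prop7SectET3DeltaOne.frakGfOne` = `frakGfR` at `Δx := DeltaOne … T_J`, reducibly): the knit's `h𝒢R` body VERBATIM at
`𝒢f L i U₀ := frakGfOne …`, for `U₀ ∈ 𝔘_k(ε₀)` in the windows, modulo `T_J`'s three rows. [cite: Balaban1985Variational, (110)–(111) p.294, (115)–(117) pp.294–295, (51) p.286] -/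
theorem frakGfOne_isHermitian_traceless_at_regPr
    {ε₀ e : ℝ} (hε₀ : 0 < ε₀) (he : 0 < e) (hWe : 10 ^ 9 * (F.L : ℝ) ^ 2 * e ≤ 1) (hWε : 10 ^ 12 * (F.L : ℝ) ^ 3 * ε₀ ≤ 1) (hreg : RegPr F n K ε₀ U₀)
    (hT : ∀ f : BondL2K ℂ 3 (periodsT3 F K) c₀ W₂, TJ U₀ (toL2 F K c₀ (star ((toL2 F K c₀).symm f))) = toL2 F K c₀ (star ((toL2 F K c₀).symm (TJ U₀ f))))
    (hTtr : ∀ A : PBond (F.P K) 0 → Matrix (Fin 2) (Fin 2) ℂ, (∀ b, (A b).trace = 0) → ∀ b, ((toL2 F K c₀).symm (TJ U₀ (toL2 F K c₀ A)) b).trace = 0)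
    (hTsymm : (TJ U₀).IsSymmetric) :
    ∀ f : NegSize (F.L : ℝ) (((F.L : ℝ)⁻¹) ^ (K - n)) (fun _ : Bond 3 (periodsT3 F K) => K - n) 3 (Matrix (Fin 2) (Fin 2) ℂ),
      (∀ b, (NegSup.equiv _ _ f b).IsHermitian ∧ (NegSup.equiv _ _ f b).trace = 0) →
      ∀ b, (JetSup.equiv _ _ _ (frakGfOne F n K h c₀ cB a TJ U₀ f) b).IsHermitian ∧ (JetSup.equiv _ _ _ (frakGfOne F n K h c₀ cB a TJ U₀ f) b).trace = 0 :=
  frakGfR_isHermitian_traceless_at_regPr_DeltaOne F n K h c₀ cB a TJ U₀ hε₀ he hWe hWε hreg hT hTtr hTsymm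

omit TJ in
/-- ★★★ **(R-𝒢) AT TODAY'S INSTANTIATION `T_J := 0` (`Δ₁ = Δ_π`, ✓`DeltaOne_zero`) — UNCONDITIONAL** at `U₀ ∈ 𝔘_k(ε₀)` in the windows: the zero J-term's three rows are trivial.
[cite: Balaban1985Variational, (110)–(111) p.294, (51) p.286; Balaban1985BackgroundPropagators, (3.119) p.419, (3.153) p.426] -/
theorem frakGfR_isHermitian_traceless_at_regPr_DeltaOne_zero
    {ε₀ e : ℝ} (hε₀ : 0 < ε₀) (he : 0 < e) (hWe : 10 ^ 9 * (F.L : ℝ) ^ 2 * e ≤ 1) (hWε : 10 ^ 12 * (F.L : ℝ) ^ 3 * ε₀ ≤ 1) (hreg : RegPr F n K ε₀ U₀) :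
    ∀ f : NegSize (F.L : ℝ) (((F.L : ℝ)⁻¹) ^ (K - n)) (fun _ : Bond 3 (periodsT3 F K) => K - n) 3 (Matrix (Fin 2) (Fin 2) ℂ),
      (∀ b, (NegSup.equiv _ _ f b).IsHermitian ∧ (NegSup.equiv _ _ f b).trace = 0) →
      ∀ b, (JetSup.equiv _ _ _ (frakGfR F n K h c₀ cB a (DeltaOne F n K h c₀ cB a (fun _ => 0)) U₀ f) b).IsHermitian ∧
        (JetSup.equiv _ _ _ (frakGfR F n K h c₀ cB a (DeltaOne F n K h c₀ cB a (fun _ => 0)) U₀ f) b).trace = 0 :=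
  frakGfR_isHermitian_traceless_at_regPr_DeltaOne F n K h c₀ cB a (fun _ => 0) U₀ hε₀ he hWe hWε hreg
    (fun f => by rw [LinearMap.zero_apply, LinearMap.zero_apply, map_zero, star_zero, map_zero])
    (fun A _ b => by rw [LinearMap.zero_apply, map_zero, Pi.zero_apply, Matrix.trace_zero])
    (fun x y => by rw [LinearMap.zero_apply, LinearMap.zero_apply, inner_zero_left, inner_zero_right])

omit TJ in
/-- … and THE SAME READ AT THE `Δ_π` SLOT `DeltaPiSlot` (the slot of the knit's `H46`∕EX-junction letters), by ✓`DeltaOne_zero`. [cite: Balaban1985BackgroundPropagators, (3.119) p.419, (3.153) p.426] -/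
theorem frakGfR_isHermitian_traceless_at_regPr_DeltaPiSlot
    {ε₀ e : ℝ} (hε₀ : 0 < ε₀) (he : 0 < e) (hWe : 10 ^ 9 * (F.L : ℝ) ^ 2 * e ≤ 1) (hWε : 10 ^ 12 * (F.L : ℝ) ^ 3 * ε₀ ≤ 1) (hreg : RegPr F n K ε₀ U₀) :
    ∀ f : NegSize (F.L : ℝ) (((F.L : ℝ)⁻¹) ^ (K - n)) (fun _ : Bond 3 (periodsT3 F K) => K - n) 3 (Matrix (Fin 2) (Fin 2) ℂ),
      (∀ b, (NegSup.equiv _ _ f b).IsHermitian ∧ (NegSup.equiv _ _ f b).trace = 0) →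
      ∀ b, (JetSup.equiv _ _ _ (frakGfR F n K h c₀ cB a (DeltaPiSlot F n K h c₀ cB a) U₀ f) b).IsHermitian ∧
        (JetSup.equiv _ _ _ (frakGfR F n K h c₀ cB a (DeltaPiSlot F n K h c₀ cB a) U₀ f) b).trace = 0 := by
  rw [← DeltaOne_zero]
  exact frakGfR_isHermitian_traceless_at_regPr_DeltaOne_zero F n K h c₀ cB a U₀ hε₀ he hWe hWε hreg

end Summit.QuantumFields.YangMills.Theorems.Prop7FrakGReality

end
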